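import Summits.BirchSwinnertonDyer.BirchSwinnertonDyer.Theorems.KolyvaginRoadThreeSchneiderTamAtThreeHeightLogNumeratorDeepSeries
import Summits.BirchSwinnertonDyer.BirchSwinnertonDyer.Theorems.KolyvaginRoadThreeSchneiderTamAtThreeHeightLogNumeratorSecondOrderCore
import HarnessLib

/-!
# Crux `SchneiderTamAtThree` (item 19154) — THE HEIGHT IS THE LOGARITHM OF THE NUMERATOR, DEEP POINTS,
# part 2a/4: the polynomial core of `x = ℘(ℓ) − b₂/12` to fourth order (exact identity + coefficient table)`

HONEST FRAMING (cell `bsd-stepL`, seat `bsd-stepL-tam3-p2` g2, WIDTH-LEVER second lane «closed-form Schneider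
local factor at 3 … finite case table proved once»; `--supports stmt-BirchSwinnertonDyer-19154 --as helper`):
THEOREMS ONLY, unconditional, route-independent (no Theses import); 0 definitions, 0 named facts, 0 sorry;
nothing here proves the crux `SchneiderTamAtThree`, Schneider's conjecture or BSD.

* `deep_poly_coeffs`, `deep_poly_bound` — the algebraic core of part 2b's `norm_x_mul_formalLog_sq_sub_le`
  (`‖x·ℓ² − 1 + (b₂/12)·ℓ² − (c₄/240)·ℓ⁴‖₃ ≤ ‖x‖₃⁻²`, the expansion `x = ℘(ℓ) − b₂/12` to fourth order): the
  EXACT polynomial identity `(1 − a₁z − a₂z² − a₃z³)S² − 1 + (b₂/12)z²S² − (c₄/240)z⁴ = Σ_{j=4}^{9} G_j zʲ`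
  (`S = 1 + ½a₁z + ⅓(a₁²+a₂)z² + ¼(a₁³+2a₁a₂+2a₃)z³`) with `G₁ = G₂ = G₃ = 0`,
  `G₄ = (−2a₁⁴ − 6a₁²a₂ − 2a₂² − 7a₁a₃ + a₄)/5` (a `3`-adic integer) and `‖G₅‖ ≤ 9`, `‖G₆‖ ≤ 27`,
  `‖G₇‖ ≤ 9`, `‖G₈‖ ≤ 3`, `‖G₉‖ ≤ 1`, whence `‖Σ G_j zʲ‖ ≤ ‖z‖⁴` for `‖z‖ ≤ 3⁻²`; and the numerics of
  `r = ‖z‖ ≤ 3⁻²` (`deep_numerics`).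

References: [SilvermanAEC2009] IV.1, IV.5–6, VI.3 (the `℘`-expansion), VII.2; tree: part 1 (`…DeepSeries`),
part 3 of the first-order chain (`norm_pow_three_div_sq_sub_le`), ui-o2 `O2SigmaValuation`.
-/

noncomputable section

open scoped Classical Nat
open Filter Topology IsUltrametricDist PowerSeries
open WeierstrassCurve Literature.NumberTheory.EllipticCurves
open Literature.NumberTheory.EllipticCurves.SteinWuthrich2013
open Literature.NumberTheory.EllipticCurves.TateCurve
open Literature.NumberTheory.EllipticCurves.Rank1Residual
open Summit.BirchSwinnertonDyer.Uniform.UI.O2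

namespace Summit.BirchSwinnertonDyer.Rank1Residual.X11b.RegMult.HeightLogNumerator

/-! ### §5 `x·ℓ² = 1 − (b₂/12)ℓ² + (c₄/240)ℓ⁴ + O(‖x‖⁻²)` -/

section WeierstrassP

/-- Small facts about `r = ‖z‖ ∈ (0, 3⁻²]` used in the deep bookkeeping. [folklore] -/
theorem deep_numerics (r : ℝ) (h0 : 0 < r) (h9 : r ≤ 1 / 9) :
    r ≤ 1 ∧ 3 * r ≤ 1 ∧ 9 * r ≤ 1 ∧ 27 * r ^ 2 ≤ 1 ∧ 3 * r ^ 2 ≤ 1 ∧ r ^ 2 ≤ r ∧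
      9 * r ^ 5 ≤ r ^ 4 ∧ 27 * r ^ 6 ≤ r ^ 4 ∧ 9 * r ^ 7 ≤ r ^ 4 ∧ 3 * r ^ 8 ≤ r ^ 4 ∧ r ^ 9 ≤ r ^ 4 ∧
      3 * r ^ 5 ≤ r ^ 4 ∧ r ^ 6 ≤ r ^ 4 ∧ r ^ 5 ≤ r ^ 4 := by
  have h1 : r ≤ 1 := by linarith
  have h3r : 3 * r ≤ 1 := by linarith
  have h9r : 9 * r ≤ 1 := by linarith
  have hr2 : 81 * r ^ 2 ≤ 1 := by nlinarith
  have h27 : 27 * r ^ 2 ≤ 1 := by nlinarith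
  have hr3 : 9 * r ^ 3 ≤ 1 := by nlinarith
  have hr4 : 3 * r ^ 4 ≤ 1 := by nlinarith
  have hr5 : r ^ 5 ≤ 1 := pow_le_one₀ h0.le h1
  have hp4 : 0 ≤ r ^ 4 := by positivity
  refine ⟨h1, h3r, h9r, h27, by nlinarith, by nlinarith, ?_, ?_, ?_, ?_, ?_, ?_, ?_, ?_⟩
  · calc 9 * r ^ 5 = (9 * r) * r ^ 4 := by ring
      _ ≤ 1 * r ^ 4 := by gcongr
      _ = r ^ 4 := one_mul _
  · calc 27 * r ^ 6 = (27 * r ^ 2) * r ^ 4 := by ring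
      _ ≤ 1 * r ^ 4 := by gcongr
      _ = r ^ 4 := one_mul _
  · calc 9 * r ^ 7 = (9 * r ^ 3) * r ^ 4 := by ring
      _ ≤ 1 * r ^ 4 := by gcongr
      _ = r ^ 4 := one_mul _
  · calc 3 * r ^ 8 = (3 * r ^ 4) * r ^ 4 := by ring
      _ ≤ 1 * r ^ 4 := by gcongr
      _ = r ^ 4 := one_mul _
  · calc r ^ 9 = r ^ 5 * r ^ 4 := by ring
      _ ≤ 1 * r ^ 4 := by gcongr
      _ = r ^ 4 := one_mul _
  · calc 3 * r ^ 5 = (3 * r) * r ^ 4 := by ring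
      _ ≤ 1 * r ^ 4 := by gcongr
      _ = r ^ 4 := one_mul _
  · calc r ^ 6 = r ^ 2 * r ^ 4 := by ring
      _ ≤ 1 * r ^ 4 := by gcongr; nlinarith
      _ = r ^ 4 := one_mul _
  · calc r ^ 5 = r * r ^ 4 := by ring
      _ ≤ 1 * r ^ 4 := by gcongr
      _ = r ^ 4 := one_mul _

/-- **The coefficient table of `x = ℘(ℓ) − b₂/12` to fourth order.** For `a₁, a₂, a₃, a₄ ∈ ℤ₃`
(norm `≤ 1`) and any `z`, with `S = 1 + ½a₁z + ⅓(a₁²+a₂)z² + ¼(a₁³+2a₁a₂+2a₃)z³`, `b₂ = a₁² + 4a₂`,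
`c₄ = b₂² − 24(2a₄ + a₁a₃)`: the EXACT identity
`(1 − a₁z − a₂z² − a₃z³)S² − 1 + (b₂/12)z²S² − (c₄/240)z⁴ = Σ_{j=4}^{9} G_j zʲ` (the coefficients of
`z, z², z³` vanish; `G₄ = (−2a₁⁴ − 6a₁²a₂ − 2a₂² − 7a₁a₃ + a₄)/5`) with `‖G₄‖ ≤ 1`, `‖G₅‖ ≤ 9`, `‖G₆‖ ≤ 27`,
`‖G₇‖ ≤ 9`, `‖G₈‖ ≤ 3`, `‖G₉‖ ≤ 1`. [folklore] -/
theorem deep_poly_coeffs {a₁ a₂ a₃ a₄ : ℚ_[3]} (ha1 : ‖a₁‖ ≤ 1) (ha2 : ‖a₂‖ ≤ 1) (ha3 : ‖a₃‖ ≤ 1)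
    (ha4 : ‖a₄‖ ≤ 1) (z : ℚ_[3]) :
    ∃ G₄ G₅ G₆ G₇ G₈ G₉ : ℚ_[3],
      (1 - a₁ * z - a₂ * z ^ 2 - a₃ * z ^ 3) *
          (1 + (2 : ℚ_[3])⁻¹ * a₁ * z + (3 : ℚ_[3])⁻¹ * (a₁ ^ 2 + a₂) * z ^ 2 +
            (4 : ℚ_[3])⁻¹ * (a₁ ^ 3 + 2 * a₁ * a₂ + 2 * a₃) * z ^ 3) ^ 2 - 1 +
        (a₁ ^ 2 + 4 * a₂) / 12 * (z ^ 2 * (1 + (2 : ℚ_[3])⁻¹ * a₁ * z + (3 : ℚ_[3])⁻¹ * (a₁ ^ 2 + a₂) * z ^ 2 +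
            (4 : ℚ_[3])⁻¹ * (a₁ ^ 3 + 2 * a₁ * a₂ + 2 * a₃) * z ^ 3) ^ 2) -
        ((a₁ ^ 2 + 4 * a₂) ^ 2 - 24 * (2 * a₄ + a₁ * a₃)) / 240 * z ^ 4 =
        G₄ * z ^ 4 + G₅ * z ^ 5 + G₆ * z ^ 6 + G₇ * z ^ 7 + G₈ * z ^ 8 + G₉ * z ^ 9 ∧
      ‖G₄‖ ≤ 1 ∧ ‖G₅‖ ≤ 9 ∧ ‖G₆‖ ≤ 27 ∧ ‖G₇‖ ≤ 9 ∧ ‖G₈‖ ≤ 3 ∧ ‖G₉‖ ≤ 1 := by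
  obtain ⟨h2n, h4n, h3n, h3i, h9i, h12i, -, -, -, -⟩ := padic_three_constants
  have h5n : ‖(5 : ℚ_[3])‖ = 1 := by
    simpa using Padic.norm_natCast_eq_one_iff.mpr (show Nat.Coprime 3 5 by decide)
  set b₂ : ℚ_[3] := a₁ ^ 2 + 4 * a₂ with hb2def
  set c₄ : ℚ_[3] := b₂ ^ 2 - 24 * (2 * a₄ + a₁ * a₃) with hc4def
  set α : ℚ_[3] := (2 : ℚ_[3])⁻¹ * a₁ with hαdef
  set β : ℚ_[3] := (3 : ℚ_[3])⁻¹ * (a₁ ^ 2 + a₂) with hβdef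
  set γ : ℚ_[3] := (4 : ℚ_[3])⁻¹ * (a₁ ^ 3 + 2 * a₁ * a₂ + 2 * a₃) with hγdef
  set S : ℚ_[3] := 1 + α * z + β * z ^ 2 + γ * z ^ 3 with hSdef
  have hα : ‖α‖ ≤ 1 := by rw [hαdef, norm_mul, norm_inv, h2n, inv_one, one_mul]; exact ha1
  have ha12 : ‖a₁ ^ 2 + a₂‖ ≤ 1 :=
    (norm_add_le_max _ _).trans (max_le (by rw [norm_pow]; exact pow_le_one₀ (norm_nonneg _) ha1) ha2)
  have hβ : ‖β‖ ≤ 3 := by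
    rw [hβdef, norm_mul, h3i]
    calc 3 * ‖a₁ ^ 2 + a₂‖ ≤ 3 * 1 := by gcongr
      _ = 3 := mul_one _
  have hγ : ‖γ‖ ≤ 1 := by
    rw [hγdef, norm_mul, norm_inv, h4n, inv_one, one_mul]
    refine (norm_add_le_max _ _).trans (max_le ((norm_add_le_max _ _).trans (max_le ?_ ?_)) ?_)
    · rw [norm_pow]; exact pow_le_one₀ (norm_nonneg _) ha1
    · rw [norm_mul, norm_mul, h2n, one_mul]
      calc ‖a₁‖ * ‖a₂‖ ≤ 1 * 1 := by gcongr
        _ = 1 := one_mul _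
    · rw [norm_mul, h2n, one_mul]; exact ha3
  have hb2 : ‖b₂‖ ≤ 1 := by
    rw [hb2def]
    refine (norm_add_le_max _ _).trans (max_le ?_ ?_)
    · rw [norm_pow]; exact pow_le_one₀ (norm_nonneg _) ha1
    · rw [norm_mul, h4n, one_mul]; exact ha2
  have hb12 : ‖b₂ / 12‖ ≤ 3 := by
    rw [div_eq_mul_inv, norm_mul, h12i]
    calc ‖b₂‖ * 3 ≤ 1 * 3 := by gcongr
      _ = 3 := one_mul _
  -- Step D: the exact polynomial identity
  set T₁ : ℚ_[3] := 2 * α with hT₁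
  set T₂ : ℚ_[3] := α ^ 2 + 2 * β with hT₂
  set T₃ : ℚ_[3] := 2 * α * β + 2 * γ with hT₃
  set T₄ : ℚ_[3] := β ^ 2 + 2 * α * γ with hT₄
  set T₅ : ℚ_[3] := 2 * β * γ with hT₅
  set T₆ : ℚ_[3] := γ ^ 2 with hT₆
  have hS2 : S ^ 2 = 1 + T₁ * z + T₂ * z ^ 2 + T₃ * z ^ 3 + T₄ * z ^ 4 + T₅ * z ^ 5 + T₆ * z ^ 6 := by
    rw [hSdef, hT₁, hT₂, hT₃, hT₄, hT₅, hT₆]; ring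
  set G₄ : ℚ_[3] := T₄ - a₁ * T₃ - a₂ * T₂ - a₃ * T₁ + b₂ / 12 * T₂ - c₄ / 240 with hG₄
  set G₅ : ℚ_[3] := T₅ - a₁ * T₄ - a₂ * T₃ - a₃ * T₂ + b₂ / 12 * T₃ with hG₅
  set G₆ : ℚ_[3] := T₆ - a₁ * T₅ - a₂ * T₄ - a₃ * T₃ + b₂ / 12 * T₄ with hG₆
  set G₇ : ℚ_[3] := -(a₁ * T₆) - a₂ * T₅ - a₃ * T₄ + b₂ / 12 * T₅ with hG₇
  set G₈ : ℚ_[3] := -(a₂ * T₆) - a₃ * T₅ + b₂ / 12 * T₆ with hG₈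
  set G₉ : ℚ_[3] := -(a₃ * T₆) with hG₉
  -- the vanishing of the coefficients of `z`, `z²`, `z³`
  have hG1 : T₁ - a₁ = 0 := by rw [hT₁, hαdef]; ring
  have hG2 : T₂ - a₁ * T₁ - a₂ + b₂ / 12 = 0 := by
    rw [hT₂, hT₁, hαdef, hβdef, hb2def]; ring
  have hG3 : T₃ - a₁ * T₂ - a₂ * T₁ - a₃ + b₂ / 12 * T₁ = 0 := by
    rw [hT₃, hT₂, hT₁, hαdef, hβdef, hγdef, hb2def]; ring
  have hpoly : (1 - a₁ * z - a₂ * z ^ 2 - a₃ * z ^ 3) * S ^ 2 - 1 + b₂ / 12 * (z ^ 2 * S ^ 2) -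
      c₄ / 240 * z ^ 4 = G₄ * z ^ 4 + G₅ * z ^ 5 + G₆ * z ^ 6 + G₇ * z ^ 7 + G₈ * z ^ 8 + G₉ * z ^ 9 := by
    have e : (1 - a₁ * z - a₂ * z ^ 2 - a₃ * z ^ 3) * S ^ 2 - 1 + b₂ / 12 * (z ^ 2 * S ^ 2) -
        c₄ / 240 * z ^ 4 = (T₁ - a₁) * z + (T₂ - a₁ * T₁ - a₂ + b₂ / 12) * z ^ 2 +
        (T₃ - a₁ * T₂ - a₂ * T₁ - a₃ + b₂ / 12 * T₁) * z ^ 3 +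
        (G₄ * z ^ 4 + G₅ * z ^ 5 + G₆ * z ^ 6 + G₇ * z ^ 7 + G₈ * z ^ 8 + G₉ * z ^ 9) := by
      rw [hS2, hG₄, hG₅, hG₆, hG₇, hG₈, hG₉]; ring
    rw [e, hG1, hG2, hG3]; ring
  -- the coefficient bounds
  have hT1n : ‖T₁‖ ≤ 1 := by rw [hT₁, norm_mul, h2n, one_mul]; exact hα
  have hT2n : ‖T₂‖ ≤ 3 := by
    rw [hT₂]
    refine (norm_add_le_max _ _).trans (max_le ?_ ?_)
    · rw [norm_pow]; exact (pow_le_one₀ (norm_nonneg _) hα).trans (by norm_num)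
    · rw [norm_mul, h2n, one_mul]; exact hβ
  have hT3n : ‖T₃‖ ≤ 3 := by
    rw [hT₃]
    refine (norm_add_le_max _ _).trans (max_le ?_ ?_)
    · rw [norm_mul, norm_mul, h2n, one_mul]
      calc ‖α‖ * ‖β‖ ≤ 1 * 3 := by gcongr
        _ = 3 := one_mul _
    · rw [norm_mul, h2n, one_mul]; exact hγ.trans (by norm_num)
  have hT4n : ‖T₄‖ ≤ 9 := by
    rw [hT₄]
    refine (norm_add_le_max _ _).trans (max_le ?_ ?_)
    · rw [norm_pow]
      calc ‖β‖ ^ 2 ≤ 3 ^ 2 := by gcongr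
        _ = 9 := by norm_num
    · rw [norm_mul, norm_mul, h2n, one_mul]
      calc ‖α‖ * ‖γ‖ ≤ 1 * 1 := by gcongr
        _ ≤ 9 := by norm_num
  have hT5n : ‖T₅‖ ≤ 3 := by
    rw [hT₅, norm_mul, norm_mul, h2n, one_mul]
    calc ‖β‖ * ‖γ‖ ≤ 3 * 1 := by gcongr
      _ = 3 := mul_one _
  have hT6n : ‖T₆‖ ≤ 1 := by rw [hT₆, norm_pow]; exact pow_le_one₀ (norm_nonneg _) hγ
  have hG4n : ‖G₄‖ ≤ 1 := by
    have e : G₄ = (5 : ℚ_[3])⁻¹ * (-(2 * a₁ ^ 4) - 6 * a₁ ^ 2 * a₂ - 2 * a₂ ^ 2 - 7 * a₁ * a₃ + a₄) := by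
      rw [hG₄, hT₄, hT₃, hT₂, hT₁, hαdef, hβdef, hγdef, hc4def, hb2def]
      ring
    rw [e, norm_mul, norm_inv, h5n, inv_one, one_mul]
    have h6 : ‖(6 : ℚ_[3])‖ ≤ 1 := by
      have h : ((6 : ℤ) : ℚ_[3]) = 6 := by norm_cast
      rw [← h]; exact Padic.norm_int_le_one 6
    have h7 : ‖(7 : ℚ_[3])‖ ≤ 1 := by
      have h : ((7 : ℤ) : ℚ_[3]) = 7 := by norm_cast
      rw [← h]; exact Padic.norm_int_le_one 7
    refine (norm_add_le_max _ _).trans (max_le ((norm_sub_le_max₃ _ _).trans (max_le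
      ((norm_sub_le_max₃ _ _).trans (max_le ((norm_sub_le_max₃ _ _).trans (max_le ?_ ?_)) ?_)) ?_)) ha4)
    · rw [norm_neg, norm_mul, h2n, one_mul, norm_pow]; exact pow_le_one₀ (norm_nonneg _) ha1
    · rw [norm_mul, norm_mul, norm_pow]
      calc ‖(6 : ℚ_[3])‖ * ‖a₁‖ ^ 2 * ‖a₂‖ ≤ 1 * 1 ^ 2 * 1 := by gcongr
        _ = 1 := by norm_num
    · rw [norm_mul, h2n, one_mul, norm_pow]; exact pow_le_one₀ (norm_nonneg _) ha2
    · rw [norm_mul, norm_mul]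
      calc ‖(7 : ℚ_[3])‖ * ‖a₁‖ * ‖a₃‖ ≤ 1 * 1 * 1 := by gcongr
        _ = 1 := by norm_num
  have hG5n : ‖G₅‖ ≤ 9 := by
    rw [hG₅]
    refine (norm_add_le_max _ _).trans (max_le ((norm_sub_le_max₃ _ _).trans (max_le
      ((norm_sub_le_max₃ _ _).trans (max_le ((norm_sub_le_max₃ _ _).trans (max_le
      (hT5n.trans (by norm_num)) ?_)) ?_)) ?_)) ?_)
    · rw [norm_mul]
      calc ‖a₁‖ * ‖T₄‖ ≤ 1 * 9 := by gcongr
        _ = 9 := one_mul _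
    · rw [norm_mul]
      calc ‖a₂‖ * ‖T₃‖ ≤ 1 * 3 := by gcongr
        _ ≤ 9 := by norm_num
    · rw [norm_mul]
      calc ‖a₃‖ * ‖T₂‖ ≤ 1 * 3 := by gcongr
        _ ≤ 9 := by norm_num
    · rw [norm_mul]
      calc ‖b₂ / 12‖ * ‖T₃‖ ≤ 3 * 3 := by gcongr
        _ = 9 := by norm_num
  have hG6n : ‖G₆‖ ≤ 27 := by
    rw [hG₆]
    refine (norm_add_le_max _ _).trans (max_le ((norm_sub_le_max₃ _ _).trans (max_le
      ((norm_sub_le_max₃ _ _).trans (max_le ((norm_sub_le_max₃ _ _).trans (max_le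
      (hT6n.trans (by norm_num)) ?_)) ?_)) ?_)) ?_)
    · rw [norm_mul]
      calc ‖a₁‖ * ‖T₅‖ ≤ 1 * 3 := by gcongr
        _ ≤ 27 := by norm_num
    · rw [norm_mul]
      calc ‖a₂‖ * ‖T₄‖ ≤ 1 * 9 := by gcongr
        _ ≤ 27 := by norm_num
    · rw [norm_mul]
      calc ‖a₃‖ * ‖T₃‖ ≤ 1 * 3 := by gcongr
        _ ≤ 27 := by norm_num
    · rw [norm_mul]
      calc ‖b₂ / 12‖ * ‖T₄‖ ≤ 3 * 9 := by gcongr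
        _ = 27 := by norm_num
  have hG7n : ‖G₇‖ ≤ 9 := by
    rw [hG₇]
    refine (norm_add_le_max _ _).trans (max_le ((norm_sub_le_max₃ _ _).trans (max_le
      ((norm_sub_le_max₃ _ _).trans (max_le ?_ ?_)) ?_)) ?_)
    · rw [norm_neg, norm_mul]
      calc ‖a₁‖ * ‖T₆‖ ≤ 1 * 1 := by gcongr
        _ ≤ 9 := by norm_num
    · rw [norm_mul]
      calc ‖a₂‖ * ‖T₅‖ ≤ 1 * 3 := by gcongr
        _ ≤ 9 := by norm_num
    · rw [norm_mul]
      calc ‖a₃‖ * ‖T₄‖ ≤ 1 * 9 := by gcongr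
        _ = 9 := one_mul _
    · rw [norm_mul]
      calc ‖b₂ / 12‖ * ‖T₅‖ ≤ 3 * 3 := by gcongr
        _ = 9 := by norm_num
  have hG8n : ‖G₈‖ ≤ 3 := by
    rw [hG₈]
    refine (norm_add_le_max _ _).trans (max_le ((norm_sub_le_max₃ _ _).trans (max_le ?_ ?_)) ?_)
    · rw [norm_neg, norm_mul]
      calc ‖a₂‖ * ‖T₆‖ ≤ 1 * 1 := by gcongr
        _ ≤ 3 := by norm_num
    · rw [norm_mul]
      calc ‖a₃‖ * ‖T₅‖ ≤ 1 * 3 := by gcongr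
        _ = 3 := one_mul _
    · rw [norm_mul]
      calc ‖b₂ / 12‖ * ‖T₆‖ ≤ 3 * 1 := by gcongr
        _ = 3 := mul_one _
  have hG9n : ‖G₉‖ ≤ 1 := by
    rw [hG₉, norm_neg, norm_mul]
    calc ‖a₃‖ * ‖T₆‖ ≤ 1 * 1 := by gcongr
      _ = 1 := one_mul _
  refine ⟨G₄, G₅, G₆, G₇, G₈, G₉, ?_, hG4n, hG5n, hG6n, hG7n, hG8n, hG9n⟩
  have hgoal : (1 - a₁ * z - a₂ * z ^ 2 - a₃ * z ^ 3) *
          (1 + (2 : ℚ_[3])⁻¹ * a₁ * z + (3 : ℚ_[3])⁻¹ * (a₁ ^ 2 + a₂) * z ^ 2 +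
            (4 : ℚ_[3])⁻¹ * (a₁ ^ 3 + 2 * a₁ * a₂ + 2 * a₃) * z ^ 3) ^ 2 - 1 +
        (a₁ ^ 2 + 4 * a₂) / 12 * (z ^ 2 * (1 + (2 : ℚ_[3])⁻¹ * a₁ * z + (3 : ℚ_[3])⁻¹ * (a₁ ^ 2 + a₂) * z ^ 2 +
            (4 : ℚ_[3])⁻¹ * (a₁ ^ 3 + 2 * a₁ * a₂ + 2 * a₃) * z ^ 3) ^ 2) -
        ((a₁ ^ 2 + 4 * a₂) ^ 2 - 24 * (2 * a₄ + a₁ * a₃)) / 240 * z ^ 4 =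
      (1 - a₁ * z - a₂ * z ^ 2 - a₃ * z ^ 3) * S ^ 2 - 1 + b₂ / 12 * (z ^ 2 * S ^ 2) - c₄ / 240 * z ^ 4 := by
    rw [hSdef, hαdef, hβdef, hγdef, hc4def, hb2def]
  rw [hgoal]
  exact hpoly

/-- **The polynomial core of `x = ℘(ℓ) − b₂/12` to fourth order**: with the notation of
`deep_poly_coeffs` and `0 < ‖z‖ ≤ 3⁻²`,
`‖(1 − a₁z − a₂z² − a₃z³)S² − 1 + (b₂/12)z²S² − (c₄/240)z⁴‖ ≤ ‖z‖⁴` (the table `1, 9, 27, 9, 3, 1` against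
`r⁴, 9r⁵, 27r⁶, 9r⁷, 3r⁸, r⁹ ≤ r⁴` for `r ≤ 3⁻²`). [folklore] -/
theorem deep_poly_bound {a₁ a₂ a₃ a₄ z : ℚ_[3]} (ha1 : ‖a₁‖ ≤ 1) (ha2 : ‖a₂‖ ≤ 1) (ha3 : ‖a₃‖ ≤ 1)
    (ha4 : ‖a₄‖ ≤ 1) (hzz : 0 < ‖z‖) (hz9 : ‖z‖ ≤ 1 / 9) :
    ‖(1 - a₁ * z - a₂ * z ^ 2 - a₃ * z ^ 3) *
          (1 + (2 : ℚ_[3])⁻¹ * a₁ * z + (3 : ℚ_[3])⁻¹ * (a₁ ^ 2 + a₂) * z ^ 2 +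
            (4 : ℚ_[3])⁻¹ * (a₁ ^ 3 + 2 * a₁ * a₂ + 2 * a₃) * z ^ 3) ^ 2 - 1 +
        (a₁ ^ 2 + 4 * a₂) / 12 * (z ^ 2 * (1 + (2 : ℚ_[3])⁻¹ * a₁ * z + (3 : ℚ_[3])⁻¹ * (a₁ ^ 2 + a₂) * z ^ 2 +
            (4 : ℚ_[3])⁻¹ * (a₁ ^ 3 + 2 * a₁ * a₂ + 2 * a₃) * z ^ 3) ^ 2) -
        ((a₁ ^ 2 + 4 * a₂) ^ 2 - 24 * (2 * a₄ + a₁ * a₃)) / 240 * z ^ 4‖ ≤ ‖z‖ ^ 4 := by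
  obtain ⟨hz1, h3z, h9z, h27z2, h3z2, hz2le, hr5, hr6, hr7, hr8, hr9, h3r5, hr6', hr5'⟩ :=
    deep_numerics ‖z‖ hzz hz9
  obtain ⟨G₄, G₅, G₆, G₇, G₈, G₉, hpoly, hG4n, hG5n, hG6n, hG7n, hG8n, hG9n⟩ :=
    deep_poly_coeffs ha1 ha2 ha3 ha4 z
  rw [hpoly]
  refine (norm_add_le_max _ _).trans (max_le ((norm_add_le_max _ _).trans (max_le
    ((norm_add_le_max _ _).trans (max_le ((norm_add_le_max _ _).trans (max_le
    ((norm_add_le_max _ _).trans (max_le ?_ ?_)) ?_)) ?_)) ?_)) ?_)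
  · rw [norm_mul, norm_pow]
    calc ‖G₄‖ * ‖z‖ ^ 4 ≤ 1 * ‖z‖ ^ 4 := by gcongr
      _ = ‖z‖ ^ 4 := one_mul _
  · rw [norm_mul, norm_pow]
    calc ‖G₅‖ * ‖z‖ ^ 5 ≤ 9 * ‖z‖ ^ 5 := by gcongr
      _ ≤ ‖z‖ ^ 4 := hr5
  · rw [norm_mul, norm_pow]
    calc ‖G₆‖ * ‖z‖ ^ 6 ≤ 27 * ‖z‖ ^ 6 := by gcongr
      _ ≤ ‖z‖ ^ 4 := hr6
  · rw [norm_mul, norm_pow]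
    calc ‖G₇‖ * ‖z‖ ^ 7 ≤ 9 * ‖z‖ ^ 7 := by gcongr
      _ ≤ ‖z‖ ^ 4 := hr7
  · rw [norm_mul, norm_pow]
    calc ‖G₈‖ * ‖z‖ ^ 8 ≤ 3 * ‖z‖ ^ 8 := by gcongr
      _ ≤ ‖z‖ ^ 4 := hr8
  · rw [norm_mul, norm_pow]
    calc ‖G₉‖ * ‖z‖ ^ 9 ≤ 1 * ‖z‖ ^ 9 := by gcongr
      _ ≤ ‖z‖ ^ 4 := by rw [one_mul]; exact hr9

end WeierstrassP

end Summit.BirchSwinnertonDyer.Rank1Residual.X11b.RegMult.HeightLogNumerator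

end
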